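import Summits.ABC.IUTFork.Cor312NaiveProvPinnedWitness
import HarnessLib

/-!
# Branch D, team D1 — KIT for the per-place/uniform separation: tuple coordinates of a tensor packet, and how ⟨(Ind1)∪(Ind2)⟩ acts on them

Record file (D-0012; abc-iut cell, rung LADDER-ABC:A2.D; abc-iut-D1-prv gen 2; team anchor's ruling R1 of 2026-08-26T07:33:59Z, kit half —
the model and the certificate are `Charitable/Thm311D1PerPlaceSeparation.lean`). TAKES NO SIDE on [IUTchIII] Cor. 3.12 or on any author;
NO `Prop` fact; one bookkeeping predicate (`PermSignedAt`) and one (Ind1)-family (`swapFamily`) on the FROZEN carrier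
`Thm311Sig`/`Thm311Multirad` over abc-iut-w4-d026's index-generic sign shells `Cor312Vol.NaiveProv.signShells T`; everything else is a theorem.
* `coordTuple j v_ℚ w` — the linear functional on the packet `⊗_{i ∈ S^±_{j+1}} (⊕_{w ∣ v_ℚ} ℚ)` reading the factor `i` at the place `w i`
  (Part I's `NaiveProv.coordAt` is the constant tuple); on pure tensors the product of the chosen coordinates (`coordTuple_tprod`).
* `PermSignedAt Φ j v_ℚ` — `Φ` acts on all tuple coordinates of the packet `(j, v_ℚ)` through ONE permutation of the capsule index set
  `S^±_{j+1}` and signs; PROVED for every element of ⟨(Ind1)∪(Ind2)⟩ (`permSignedAt_of_mem_closure`: (Ind1) = the procession's capsule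
  permutation + sign strip-automorphisms, (Ind2) = signs, closed under products and inverses) — S. Mochizuki, *Inter-universal Teichmüller
  theory III*, kurims (May 2020), Thm. 3.11 (i) (Ind1), (Ind2), p. 154; [IUTchI] §0 (capsule-full poly-isomorphisms).
* `swapFamily` — the (Ind1)-family swapping the capsule index `α = j` with `0` (`swapFamily_mem_Ind1Family`).
* `tau_self_of_fixes` / `tau_self_of_swaps` — in a packet under a place `u` with a SECOND place `z ≠ u` over `v_ℚ(u)`: if `Φ` fixes the
  one-factor splitting monoid `Ψ_u` (Part I `NaiveProv.PsiOf (thetaVec1 p) u`) as a set, its capsule permutation fixes `α = j`; if `Φ`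
  realises the capsule swap on `Ψ_u`, its capsule permutation sends `α = j` to `0` — read through `coordTuple_thetaVec1`.
[claim: Mochizuki2012, status: disputed] (node texts) Standard axioms; elementary bookkeeping on the typed carrier; typed ≠ proved.
-/

noncomputable section

open Set
open scoped TensorProduct

namespace Summit.ABC.IUTFork.Charitable

open Thm311 Cor312 Cor312Vol Literature.IUT.LogThetaLattice

variable {T : ThetaIndex}

/-! ## 1. Tuple coordinates of a tensor packet -/

/-- The TUPLE-COORDINATE functional of the packet `⊗_{i ∈ S^±_{j+1}} (⊕_{w ∣ v_ℚ} ℚ)`: project the factor `i` to the summand `w i`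
and multiply (Part I's `coordAt` is the constant tuple). [folklore] -/
def coordTuple (j : T.Label) (vQ : T.VQ) (w : T.Caps j → T.Fibre vQ) : (NaiveProv.signShells T).Packet j vQ →ₗ[ℚ] ℚ :=
  (PiTensorProduct.constantBaseRingEquiv (T.Caps j) ℚ).toLinearEquiv.toLinearMap ∘ₗ
    PiTensorProduct.map fun i : T.Caps j =>
      (LinearMap.proj (w i) : (NaiveProv.signShells T).Packet1 vQ →ₗ[ℚ] ℚ)

/-- On a pure tensor the tuple coordinate is the product of the chosen coordinates of the factors. [folklore] -/
theorem coordTuple_tprod (j : T.Label) (vQ : T.VQ) (w : T.Caps j → T.Fibre vQ)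
    (y : T.Caps j → (NaiveProv.signShells T).Packet1 vQ) :
    coordTuple j vQ w (PiTensorProduct.tprod ℚ y) = ∏ i, (y i (w i) : ℚ) := by
  unfold coordTuple
  rw [LinearMap.comp_apply]
  erw [PiTensorProduct.map_tprod]
  change (PiTensorProduct.constantBaseRingEquiv (T.Caps j) ℚ)
      (PiTensorProduct.tprod ℚ fun i : T.Caps j => (y i (w i) : ℚ)) = _
  rw [PiTensorProduct.constantBaseRingEquiv_tprod]

/-- Two linear functionals that differ by the factor `ε` on pure tensors differ by `ε` everywhere. [folklore] -/
theorem eq_mul_of_tprod {j : T.Label} {vQ : T.VQ}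
    (L₁ L₂ : (⨂[ℚ] _ : T.Caps j, (NaiveProv.signShells T).Packet1 vQ) →ₗ[ℚ] ℚ) (ε : ℚ)
    (h : ∀ y, L₁ (PiTensorProduct.tprod ℚ y) = ε * L₂ (PiTensorProduct.tprod ℚ y))
    (t : ⨂[ℚ] _ : T.Caps j, (NaiveProv.signShells T).Packet1 vQ) : L₁ t = ε * L₂ t := by
  induction t using PiTensorProduct.induction_on with
  | smul_tprod r y => rw [map_smul, map_smul, h y, smul_eq_mul, smul_eq_mul]; ring
  | add x y hx hy => rw [map_add, map_add, hx, hy]; ring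

/-! ## 2. Every element of ⟨(Ind1)∪(Ind2)⟩ acts on tuple coordinates by a capsule permutation and a sign -/

/-- `Φ` acts on the tuple coordinates of the packet `(j, v_ℚ)` by ONE permutation `τ` of the capsule index set and signs:
`coordTuple w ∘ Φ = ± coordTuple (w ∘ τ)` for every tuple `w`. Bookkeeping predicate on the frozen carrier. [folklore] -/
def PermSignedAt (Φ : (NaiveProv.signShells T).PacketAut) (j : T.Label) (vQ : T.VQ) : Prop :=
  ∃ τ : Equiv.Perm (T.Caps j), ∀ w : T.Caps j → T.Fibre vQ, ∃ ε : ℚ, |ε| = 1 ∧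
    ∀ t, coordTuple j vQ w (Φ j vQ t) = ε * coordTuple j vQ (fun i => w (τ i)) t

/-- (Ind2)-families act by signs and the identity permutation. [folklore] -/
theorem permSignedAt_of_mem_Ind2Family {Φ : (NaiveProv.signShells T).PacketAut}
    (h : Φ ∈ (NaiveProv.signShells T).Ind2Family) (j : T.Label) (vQ : T.VQ) : PermSignedAt Φ j vQ := by
  obtain ⟨g, hg, hΦ⟩ := h j vQ
  refine ⟨Equiv.refl _, fun w => ?_⟩
  choose s hs hgs using fun i => Cor312.IdentifiedNonVacuity.exists_eq_mul_of_mem_signs (hg i (w i))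
  refine ⟨∏ i, s i, Cor312.IdentifiedNonVacuity.abs_prod_eq_one hs, ?_⟩
  refine eq_mul_of_tprod ((coordTuple j vQ w).comp (Φ j vQ).toLinearMap) (coordTuple j vQ fun i => w (Equiv.refl _ i))
    _ fun y => ?_
  have hL : coordTuple j vQ w (Φ j vQ ((NaiveProv.signShells T).tprod j vQ y)) = ∏ i, s i * y i (w i) := by
    rw [hΦ, LogShells.factorwise_summandwise_tprod]
    show coordTuple j vQ w (PiTensorProduct.tprod ℚ fun i v => g i v (y i v)) = _
    rw [coordTuple_tprod]
    exact Finset.prod_congr rfl fun i _ => hgs i _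
  have hR : coordTuple j vQ (fun i => w (Equiv.refl _ i)) (PiTensorProduct.tprod ℚ y) = ∏ i, y i (w i) :=
    coordTuple_tprod _ _ _ _
  show coordTuple j vQ w (Φ j vQ ((NaiveProv.signShells T).tprod j vQ y)) =
    (∏ i, s i) * coordTuple j vQ (fun i => w (Equiv.refl _ i)) (PiTensorProduct.tprod ℚ y)
  rw [hL, hR, ← Finset.prod_mul_distrib]

/-- (Ind1)-families act by signs and the procession's capsule permutation. [folklore] -/
theorem permSignedAt_of_mem_Ind1Family {Φ : (NaiveProv.signShells T).PacketAut}
    (h : Φ ∈ (NaiveProv.signShells T).Ind1Family) (j : T.Label) (vQ : T.VQ) : PermSignedAt Φ j vQ := by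
  obtain ⟨σ, g, hg, hΦ⟩ := h j
  have hΦ' : Φ j vQ = ((NaiveProv.signShells T).permute j vQ σ).trans
      ((NaiveProv.signShells T).factorwise j vQ fun i =>
        (NaiveProv.signShells T).summandwise vQ fun v => g i v.1) := hΦ vQ
  refine ⟨σ, fun w => ?_⟩
  choose s hs hgs using fun i => Cor312.IdentifiedNonVacuity.exists_eq_mul_of_mem_signs (hg i (w i).1)
  refine ⟨∏ i, s i, Cor312.IdentifiedNonVacuity.abs_prod_eq_one hs, ?_⟩
  refine eq_mul_of_tprod ((coordTuple j vQ w).comp (Φ j vQ).toLinearMap) (coordTuple j vQ fun i => w (σ i)) _ fun y => ?_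
  show coordTuple j vQ w (Φ j vQ ((NaiveProv.signShells T).tprod j vQ y)) = _
  rw [hΦ', LinearEquiv.trans_apply, LogShells.permute_tprod, LogShells.factorwise_summandwise_tprod]
  have hL : coordTuple j vQ w ((NaiveProv.signShells T).tprod j vQ fun i (v : T.Fibre vQ) =>
      g i v.1 ((fun i => y (σ.symm i)) i v)) = ∏ i, s i * y (σ.symm i) (w i) := by
    show coordTuple j vQ w (PiTensorProduct.tprod ℚ fun i (v : T.Fibre vQ) => g i v.1 (y (σ.symm i) v)) = _
    rw [coordTuple_tprod]
    exact Finset.prod_congr rfl fun i _ => hgs i _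
  have hR : coordTuple j vQ (fun i => w (σ i)) (PiTensorProduct.tprod ℚ y) = ∏ i, y i (w (σ i)) :=
    coordTuple_tprod _ _ _ _
  rw [hL]
  calc ∏ i, s i * y (σ.symm i) (w i) = ∏ k, (s (σ k) * y (σ.symm (σ k)) (w (σ k))) :=
        (Equiv.prod_comp σ (fun i => s i * y (σ.symm i) (w i))).symm
    _ = ∏ k, (s (σ k) * y k (w (σ k))) := by simp only [Equiv.symm_apply_apply]
    _ = (∏ k, s (σ k)) * ∏ k, y k (w (σ k)) := Finset.prod_mul_distrib
    _ = (∏ i, s i) * ∏ k, y k (w (σ k)) := by rw [Equiv.prod_comp σ s]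
    _ = (∏ i, s i) * coordTuple j vQ (fun i => w (σ i)) (PiTensorProduct.tprod ℚ y) :=
        congrArg (fun z : ℚ => (∏ i, s i) * z) hR.symm

/-- The invariant holds for every element of the indeterminacy group ⟨(Ind1)∪(Ind2)⟩ (closure induction). [folklore] -/
theorem permSignedAt_of_mem_closure {Φ : (NaiveProv.signShells T).PacketAut}
    (h : Φ ∈ Subgroup.closure ((NaiveProv.signShells T).Ind1Family ∪ (NaiveProv.signShells T).Ind2Family))
    (j : T.Label) (vQ : T.VQ) : PermSignedAt Φ j vQ := by
  induction h using Subgroup.closure_induction with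
  | mem Ψ hΨ =>
    rcases hΨ with h1 | h2
    · exact permSignedAt_of_mem_Ind1Family h1 j vQ
    · exact permSignedAt_of_mem_Ind2Family h2 j vQ
  | one =>
    refine ⟨Equiv.refl _, fun w => ⟨1, abs_one, fun t => ?_⟩⟩
    simp only [Pi.one_apply, LinearEquiv.one_eq_refl, LinearEquiv.refl_apply, Equiv.refl_apply, one_mul]
  | mul Ψ Ψ' _ _ hΨ hΨ' =>
    obtain ⟨τ, hτ⟩ := hΨ
    obtain ⟨τ', hτ'⟩ := hΨ'
    refine ⟨τ * τ', fun w => ?_⟩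
    obtain ⟨ε, hε, hw⟩ := hτ w
    obtain ⟨ε', hε', hw'⟩ := hτ' fun i => w (τ i)
    refine ⟨ε * ε', by rw [abs_mul, hε, hε', one_mul], fun t => ?_⟩
    simp only [Pi.mul_apply, LinearEquiv.mul_apply, Equiv.Perm.mul_apply]
    rw [hw, hw', mul_assoc]
  | inv Ψ _ hΨ =>
    obtain ⟨τ, hτ⟩ := hΨ
    refine ⟨τ.symm, fun w => ?_⟩
    obtain ⟨ε, hε, hw⟩ := hτ fun i => w (τ.symm i)
    have hεε : ε * ε = 1 := NaiveProv.mul_self_of_abs_eq_one hε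
    refine ⟨ε, hε, fun t => ?_⟩
    simp only [Pi.inv_apply, LinearEquiv.coe_inv]
    have h1 := hw ((Ψ j vQ).symm t)
    rw [LinearEquiv.apply_symm_apply] at h1
    simp only [Equiv.symm_apply_apply] at h1
    calc coordTuple j vQ w ((Ψ j vQ).symm t)
        = ε * (ε * coordTuple j vQ w ((Ψ j vQ).symm t)) := by rw [← mul_assoc, hεε, one_mul]
      _ = ε * coordTuple j vQ (fun i => w (τ.symm i)) t := by rw [← h1]

/-! ## 3. The (Ind1) capsule swap -/

/-- **The (Ind1)-family SWAPPING the capsule index `α = j` with `0`** at every label and rational place (identity strip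
automorphisms): an automorphism of the procession of 𝒟⊢-prime-strips, [IUTchIII] Thm. 3.11 (i) (Ind1) p. 154. [claim: Mochizuki2012, status: disputed] -/
def swapFamily : (NaiveProv.signShells T).PacketAut := fun j vQ =>
  (NaiveProv.signShells T).permute j vQ (Equiv.swap (T.selfIndex j) 0)

/-- `swapFamily` IS an (Ind1)-family of the frozen carrier. [folklore] -/
theorem swapFamily_mem_Ind1Family : (swapFamily : (NaiveProv.signShells T).PacketAut) ∈ (NaiveProv.signShells T).Ind1Family :=
  fun j => ⟨Equiv.swap (T.selfIndex j) 0, fun _ _ => LinearEquiv.refl ℚ _,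
    fun _ _ => (NaiveProv.signShells T).one_mem_stripAut _, fun vQ => by
      show swapFamily j vQ = _
      rw [LogShells.summandwise_refl_family, LogShells.factorwise_refl, LinearEquiv.trans_refl]
      rfl⟩

/-- `swapFamily` lies in the indeterminacy group ⟨(Ind1)∪(Ind2)⟩. [folklore] -/
theorem swapFamily_mem_closure :
    (swapFamily : (NaiveProv.signShells T).PacketAut) ∈
      Subgroup.closure ((NaiveProv.signShells T).Ind1Family ∪ (NaiveProv.signShells T).Ind2Family) :=
  Subgroup.subset_closure (Or.inl swapFamily_mem_Ind1Family)

/-- The identity family transports nothing. [folklore] -/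
theorem starAut_one_image (w : T.V) (X : Set ((NaiveProv.signShells T).StarPacket w)) :
    (NaiveProv.signShells T).starAut 1 w '' X = X := by
  have h1 : ∀ x, (NaiveProv.signShells T).starAut 1 w x = x := fun x => by
    funext j
    simp [LogShells.starAut]
  ext x
  constructor
  · rintro ⟨y, hy, rfl⟩; rwa [h1]
  · exact fun hx => ⟨x, hx, h1 x⟩

/-! ## 4. Tuple coordinates of the one-factor theta vectors; the two constraints on a capsule permutation -/

section Theta

variable (p : ℕ) [hp : Fact p.Prime]

omit hp in
open scoped Classical in
/-- The tuple coordinate of the one-factor theta vector: `q^{j²}` if the `α = j` factor is read at `v`, else `0`. [folklore] -/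
theorem coordTuple_thetaVec1 (u : T.V) (j : T.Label) (w : T.Caps j → T.Fibre (T.over u)) :
    coordTuple j (T.over u) w (NaiveProv.thetaVec1 p u j) =
      if w (T.selfIndex j) = T.toFibre u then (p : ℚ) ^ ((j : ℕ) ^ 2) else 0 := by
  classical
  unfold NaiveProv.thetaVec1
  rw [coordTuple_tprod, Finset.prod_eq_single (T.selfIndex j)]
  · simp
  · intro i _ hi
    simp [hi]
  · intro h
    exact absurd (Finset.mem_univ _) h

omit hp in
/-- The `j`-components of the elements of `Ψ_u` are `±θ_{u,j}`: their tuple coordinates are `±` those of the theta vector. [folklore] -/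
theorem coordTuple_of_mem_PsiOf {u : T.V} {f : (NaiveProv.signShells T).StarPacket u}
    (hf : f ∈ NaiveProv.PsiOf (NaiveProv.thetaVec1 p) u) (j : T.LabelStar) (w : T.Caps j.1 → T.Fibre (T.over u)) :
    coordTuple j.1 (T.over u) w (f j) = coordTuple j.1 (T.over u) w (NaiveProv.thetaVec1 p u j.1) ∨
      coordTuple j.1 (T.over u) w (f j) = -coordTuple j.1 (T.over u) w (NaiveProv.thetaVec1 p u j.1) := by
  rcases hf j with h | h
  · exact Or.inl (by rw [h])
  · exact Or.inr (by rw [h, map_neg])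

/-- **Constraint at a place where `Φ` FIXES the splitting monoid** (as a set): the capsule permutation of `Φ` at `(j, v_ℚ(u))` fixes the
index `α = j` — read the `α = j` factor at `u` and every other factor at a second place `z ≠ u` over `v_ℚ(u)`. [folklore] -/
theorem tau_self_of_fixes {Φ : (NaiveProv.signShells T).PacketAut} {u : T.V} (z : T.Fibre (T.over u)) (hz : z ≠ T.toFibre u)
    (j : T.LabelStar)
    (hfix : NaiveProv.PsiOf (NaiveProv.thetaVec1 p) u =
      (NaiveProv.signShells T).starAut Φ u '' NaiveProv.PsiOf (NaiveProv.thetaVec1 p) u)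
    {τ : Equiv.Perm (T.Caps j.1)}
    (hτ : ∀ w : T.Caps j.1 → T.Fibre (T.over u), ∃ ε : ℚ, |ε| = 1 ∧
      ∀ t, coordTuple j.1 (T.over u) w (Φ j.1 (T.over u) t) = ε * coordTuple j.1 (T.over u) (fun i => w (τ i)) t) :
    τ (T.selfIndex j.1) = T.selfIndex j.1 := by
  classical
  by_contra hne
  obtain ⟨f, hf, hfeq⟩ : NaiveProv.thetaTupleOf (NaiveProv.thetaVec1 p) u ∈
      (NaiveProv.signShells T).starAut Φ u '' NaiveProv.PsiOf (NaiveProv.thetaVec1 p) u :=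
    hfix ▸ NaiveProv.thetaTupleOf_mem_PsiOf _ u
  have hcomp : Φ j.1 (T.over u) (f j) = NaiveProv.thetaVec1 p u j.1 := by
    have := congrArg (fun g => g j) hfeq
    simpa [LogShells.starAut, NaiveProv.thetaTupleOf] using this
  let w : T.Caps j.1 → T.Fibre (T.over u) := fun i => if i = T.selfIndex j.1 then T.toFibre u else z
  obtain ⟨ε, -, hw⟩ := hτ w
  have h := hw (f j)
  rw [hcomp, coordTuple_thetaVec1, if_pos (by simp [w])] at h
  have h0 : coordTuple j.1 (T.over u) (fun i => w (τ i)) (NaiveProv.thetaVec1 p u j.1) = 0 := by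
    rw [coordTuple_thetaVec1, if_neg]
    simp [w, hne, hz]
  have hP : (p : ℚ) ^ ((j.1 : ℕ) ^ 2) ≠ 0 := pow_ne_zero _ (Nat.cast_ne_zero.mpr hp.out.ne_zero)
  rcases coordTuple_of_mem_PsiOf p hf j (fun i => w (τ i)) with h' | h'
  · rw [h', h0, mul_zero] at h; exact hP h
  · rw [h', h0, neg_zero, mul_zero] at h; exact hP h

/-- **Constraint at a place where `Φ` realises the capsule SWAP on the splitting monoid**: the capsule permutation of `Φ` at
`(j, v_ℚ(u))` moves `α = j` to `0`. [folklore] -/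
theorem tau_self_of_swaps {Φ : (NaiveProv.signShells T).PacketAut} {u : T.V} (z : T.Fibre (T.over u)) (hz : z ≠ T.toFibre u)
    (j : T.LabelStar)
    (hswap : (NaiveProv.signShells T).starAut swapFamily u '' NaiveProv.PsiOf (NaiveProv.thetaVec1 p) u =
      (NaiveProv.signShells T).starAut Φ u '' NaiveProv.PsiOf (NaiveProv.thetaVec1 p) u)
    {τ : Equiv.Perm (T.Caps j.1)}
    (hτ : ∀ w : T.Caps j.1 → T.Fibre (T.over u), ∃ ε : ℚ, |ε| = 1 ∧
      ∀ t, coordTuple j.1 (T.over u) w (Φ j.1 (T.over u) t) = ε * coordTuple j.1 (T.over u) (fun i => w (τ i)) t) :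
    τ (T.selfIndex j.1) = 0 := by
  classical
  by_contra hne
  obtain ⟨f, hf, hfeq⟩ : (NaiveProv.signShells T).starAut swapFamily u (NaiveProv.thetaTupleOf (NaiveProv.thetaVec1 p) u) ∈
      (NaiveProv.signShells T).starAut Φ u '' NaiveProv.PsiOf (NaiveProv.thetaVec1 p) u :=
    hswap ▸ ⟨_, NaiveProv.thetaTupleOf_mem_PsiOf _ u, rfl⟩
  have hcomp : Φ j.1 (T.over u) (f j) =
      (NaiveProv.signShells T).permute j.1 (T.over u) (Equiv.swap (T.selfIndex j.1) 0) (NaiveProv.thetaVec1 p u j.1) := by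
    have := congrArg (fun g => g j) hfeq
    simpa [LogShells.starAut, swapFamily, NaiveProv.thetaTupleOf] using this
  let w : T.Caps j.1 → T.Fibre (T.over u) := fun i => if i = 0 then T.toFibre u else z
  obtain ⟨ε, -, hw⟩ := hτ w
  have h := hw (f j)
  -- left side: the swapped theta vector read along `w` is `q^{j²}`
  have hL : coordTuple j.1 (T.over u) w ((NaiveProv.signShells T).permute j.1 (T.over u) (Equiv.swap (T.selfIndex j.1) 0)
      (NaiveProv.thetaVec1 p u j.1)) = (p : ℚ) ^ ((j.1 : ℕ) ^ 2) := by
    unfold NaiveProv.thetaVec1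
    rw [show PiTensorProduct.tprod ℚ _ = (NaiveProv.signShells T).tprod j.1 (T.over u) _ from rfl, LogShells.permute_tprod]
    show coordTuple j.1 (T.over u) w (PiTensorProduct.tprod ℚ fun i => _) = _
    rw [coordTuple_tprod, Finset.prod_eq_single (0 : T.Caps j.1)]
    · simp [w, Equiv.swap_apply_right]
    · intro i _ hi
      have hi' : (Equiv.swap (T.selfIndex j.1) 0) i ≠ T.selfIndex j.1 := by
        intro h'
        have := congrArg (Equiv.swap (T.selfIndex j.1) 0) h'
        rw [Equiv.swap_apply_self, Equiv.swap_apply_left] at this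
        exact hi this
      simp [hi']
    · intro h
      exact absurd (Finset.mem_univ _) h
  rw [hcomp, hL] at h
  have h0 : coordTuple j.1 (T.over u) (fun i => w (τ i)) (NaiveProv.thetaVec1 p u j.1) = 0 := by
    rw [coordTuple_thetaVec1, if_neg]
    simp [w, hne, hz]
  have hP : (p : ℚ) ^ ((j.1 : ℕ) ^ 2) ≠ 0 := pow_ne_zero _ (Nat.cast_ne_zero.mpr hp.out.ne_zero)
  rcases coordTuple_of_mem_PsiOf p hf j (fun i => w (τ i)) with h' | h'
  · rw [h', h0, mul_zero] at h; exact hP h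
  · rw [h', h0, neg_zero, mul_zero] at h; exact hP h

/-- The label `l⋆ ∈ 𝔽_l^⋆` (nonzero since `l⋆ ≥ 2`). [folklore] -/
def labelLast (T : ThetaIndex) : T.LabelStar :=
  ⟨Fin.last T.lstar, fun h0 => by
    have hl := T.two_le_lstar
    have := congrArg Fin.val h0
    simp at this
    omega⟩

/-- At the label `l⋆` the capsule index `α = j` is not `0`. [folklore] -/
theorem selfIndex_labelLast_ne_zero (T : ThetaIndex) : T.selfIndex (labelLast T).1 ≠ 0 := by
  intro h
  have := congrArg Fin.val h
  have hl := T.two_le_lstar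
  simp [ThetaIndex.selfIndex, labelLast] at this
  omega

end Theta

end Summit.ABC.IUTFork.Charitable

end
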